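import Summits.CriticalPhenomena.PercolationContinuityZ3.Theorems.PercNearOneGluingNoHeavyLowerTailSahiOneStepSharedBitKLevel
import Mathlib.Tactic.LinearCombination
import HarnessLib

/-!
# One shared coordinate: the window step of the three-chain collapse lemma

Support file (prover prim-ineq-prove-3 gen 26; `--supports stmt-CriticalPhenomena-4575`; memo
`run/shared/lean/prim/prim-ineq-prove-3/FINDING-G26-ONE-SHARED-COORDINATE.md` §1, Step 1 / (1.2)).  No definitions, no sorries.

`window_step`: for the shared-bit three-chain functional `N′` (see `…SharedBitKLevel`) with a STAIRCASE first slot (`α z k = a k`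
iff `θ z ≤ k`, `θ 1 ≤ θ 0`) and any increasing second slot whose private chain `b` is pairwise log-concave: if `N′ ≥ 0` for the
instance RESTRICTED to the window `W = [θ 1, θ 0)` with the first slot replaced by the shared bit, then `N′ ≥ 0`.  Proof: per-`k`
evaluation of the staircase (regions below / inside / above the window), ball monotonicity (`ballMass_le`) for the second slot and
for the bit, and `klevel_ineq`.  Log-concavity enters only through `ballMass_le`.
-/

namespace Summit.CriticalPhenomena.PercolationContinuityZ3.Theorems

namespace SahiOneStep

namespace ThreeChain

open Finset

/-- **THE WINDOW STEP.**  For the shared-bit three-chain functional with a STAIRCASE first slot (`α z k = a k` iff `θ z ≤ k`,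
`θ 1 ≤ θ 0`) and an arbitrary increasing second slot (masses `β`, private chain `b` pairwise log-concave): if the functional of the
RESTRICTED instance — first chain restricted to the window `W = [θ 1, θ 0)`, first slot replaced by the shared bit — is nonnegative,
then so is the functional of the original instance (memo §1, Step 1: condition on the first private chain; the cross terms between
the window and its complement have the good sign by ball monotonicity; `ℓ ≥ ℓ_W`). [this work] -/
theorem window_step (K J t : ℕ) (c a b : ℕ → ℝ) (θ : ℕ → ℕ) (β : ℕ → ℕ → ℝ)
    (hc : ∀ z, 0 ≤ c z) (hc1 : c 0 + c 1 = 1) (ha : ∀ k, 0 ≤ a k)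
    (hb : ∀ j, 0 ≤ b j) (hbJ : ∀ j, J < j → b j = 0) (hblc : ∀ i j, i < j → b i * b (j + 1) ≤ b (i + 1) * b j)
    (hβ0 : ∀ z j, 0 ≤ β z j) (hβb : ∀ z j, β z j ≤ b j) (hβz : ∀ j, β 0 j ≤ β 1 j)
    (hβj : ∀ z j j', j ≤ j' → β z j * b j' ≤ β z j' * b j) (hθ : θ 1 ≤ θ 0)
    (hW : 0 ≤
      (∑ z ∈ range 2, ∑ k ∈ range (K + 1), ∑ j ∈ range (J + 1),
          if z + k + j < t then c z * (if θ 1 ≤ k ∧ k < θ 0 then a k else 0) * b j else 0) *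
          (∑ z ∈ range 2, ∑ k ∈ range (K + 1), ∑ j ∈ range (J + 1),
            if z + k + j < t then 0 else c z * (if z = 1 then (if θ 1 ≤ k ∧ k < θ 0 then a k else 0) else 0) * β z j)
        + (∑ z ∈ range 2, ∑ k ∈ range (K + 1), ∑ j ∈ range (J + 1),
            if z + k + j < t then c z * (if z = 1 then (if θ 1 ≤ k ∧ k < θ 0 then a k else 0) else 0) * b j else 0) *
          (∑ z ∈ range 2, ∑ k ∈ range (K + 1), ∑ j ∈ range (J + 1),
            if z + k + j < t then c z * (if θ 1 ≤ k ∧ k < θ 0 then a k else 0) * β z j else 0)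
        - (∑ z ∈ range 2, ∑ k ∈ range (K + 1), ∑ j ∈ range (J + 1),
            if z + k + j < t then c z * (if θ 1 ≤ k ∧ k < θ 0 then a k else 0) * b j else 0) *
          (∑ z ∈ range 2, ∑ k ∈ range (K + 1), c z * (if z = 1 then (if θ 1 ≤ k ∧ k < θ 0 then a k else 0) else 0)) *
          (∑ z ∈ range 2, ∑ j ∈ range (J + 1), c z * β z j)) :
    0 ≤ (∑ z ∈ range 2, ∑ k ∈ range (K + 1), ∑ j ∈ range (J + 1), if z + k + j < t then c z * a k * b j else 0) *
          (∑ z ∈ range 2, ∑ k ∈ range (K + 1), ∑ j ∈ range (J + 1),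
            if z + k + j < t then 0 else c z * (if θ z ≤ k then a k else 0) * β z j)
        + (∑ z ∈ range 2, ∑ k ∈ range (K + 1), ∑ j ∈ range (J + 1),
            if z + k + j < t then c z * (if θ z ≤ k then a k else 0) * b j else 0) *
          (∑ z ∈ range 2, ∑ k ∈ range (K + 1), ∑ j ∈ range (J + 1), if z + k + j < t then c z * a k * β z j else 0)
        - (∑ z ∈ range 2, ∑ k ∈ range (K + 1), ∑ j ∈ range (J + 1), if z + k + j < t then c z * a k * b j else 0) *
          (∑ z ∈ range 2, ∑ k ∈ range (K + 1), c z * (if θ z ≤ k then a k else 0)) *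
          (∑ z ∈ range 2, ∑ j ∈ range (J + 1), c z * β z j) := by
  -- per-`k` quantities
  set aW : ℕ → ℝ := fun k => if θ 1 ≤ k ∧ k < θ 0 then a k else 0 with haW
  set ℓk : ℕ → ℝ := fun k => ∑ z ∈ range 2, ∑ j ∈ range (J + 1), if z + k + j < t then c z * b j else 0 with hℓk
  set Gk : ℕ → ℝ := fun k => ∑ z ∈ range 2, ∑ j ∈ range (J + 1), if z + k + j < t then c z * β z j else 0 with hGk
  set Zk : ℕ → ℝ := fun k => ∑ z ∈ range 2, ∑ j ∈ range (J + 1),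
    if z + k + j < t then c z * (if z = 1 then b j else 0) else 0 with hZk
  set Φ1 : ℕ → ℝ := fun k => ∑ j ∈ range (J + 1), if 1 + k + j < t then 0 else c 1 * β 1 j with hΦ1
  set gbar : ℝ := ∑ z ∈ range 2, ∑ j ∈ range (J + 1), c z * β z j with hgbar
  set G : ℕ → ℝ := fun k => if 0 < ℓk k then Gk k / ℓk k else 0 with hG
  set Fw : ℕ → ℝ := fun k => if 0 < ℓk k then Zk k / ℓk k else 0 with hFw
  set F : ℕ → ℝ := fun k => if k < θ 1 then 0 else if k < θ 0 then Fw k else 1 with hF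
  set E : ℕ → ℝ := fun k => Φ1 k - c 1 * gbar + Zk k * G k with hE
  set u : ℕ → ℝ := fun k => a k * ℓk k with hu
  set uW : ℕ → ℝ := fun k => aW k * ℓk k with huW
  -- basic bounds
  have haW0 : ∀ k, 0 ≤ aW k := fun k => by simp only [haW]; split_ifs; exacts [ha k, le_rfl]
  have haWle : ∀ k, aW k ≤ a k := fun k => by simp only [haW]; split_ifs; exacts [le_rfl, ha k]
  have hℓk0 : ∀ k, 0 ≤ ℓk k := fun k => ballSum_nonneg J _ _ fun z j => mul_nonneg (hc z) (hb j)
  have hGk0 : ∀ k, 0 ≤ Gk k := fun k => ballSum_nonneg J _ _ fun z j => mul_nonneg (hc z) (hβ0 z j)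
  have hGkle : ∀ k, Gk k ≤ ℓk k := fun k =>
    ballSum_le_ballMass J _ c b _ fun z j => mul_le_mul_of_nonneg_left (hβb z j) (hc z)
  have hZk0 : ∀ k, 0 ≤ Zk k := fun k => ballSum_nonneg J _ _ fun z j =>
    mul_nonneg (hc z) (by split_ifs; exacts [hb j, le_rfl])
  have hZkle : ∀ k, Zk k ≤ ℓk k := fun k =>
    ballSum_le_ballMass J _ c b _ fun z j => mul_le_mul_of_nonneg_left (by split_ifs; exacts [le_rfl, hb j]) (hc z)
  have hG0 : ∀ k, 0 ≤ G k := fun k => by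
    simp only [hG]; split_ifs with h; exacts [div_nonneg (hGk0 k) h.le, le_rfl]
  have hGle1 : ∀ k, G k ≤ 1 := fun k => by
    simp only [hG]; split_ifs with h; exacts [(div_le_one h).2 (hGkle k), zero_le_one]
  have hFw0 : ∀ k, 0 ≤ Fw k := fun k => by
    simp only [hFw]; split_ifs with h; exacts [div_nonneg (hZk0 k) h.le, le_rfl]
  have hFwle1 : ∀ k, Fw k ≤ 1 := fun k => by
    simp only [hFw]; split_ifs with h; exacts [(div_le_one h).2 (hZkle k), zero_le_one]
  have hGkG : ∀ k, Gk k = ℓk k * G k := fun k => by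
    simp only [hG]; split_ifs with h
    · rw [mul_div_cancel₀ _ h.ne']
    · have h0 : ℓk k = 0 := le_antisymm (not_lt.1 h) (hℓk0 k)
      rw [h0, zero_mul]; exact le_antisymm (h0 ▸ hGkle k) (hGk0 k)
  have hZkF : ∀ k, Zk k = ℓk k * Fw k := fun k => by
    simp only [hFw]; split_ifs with h
    · rw [mul_div_cancel₀ _ h.ne']
    · have h0 : ℓk k = 0 := le_antisymm (not_lt.1 h) (hℓk0 k)
      rw [h0, zero_mul]; exact le_antisymm (h0 ▸ hZkle k) (hZk0 k)
  -- (A) monotonicity of the ball-conditional means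
  have hball : ∀ k k', k ≤ k' → Gk k' * ℓk k ≤ Gk k * ℓk k' := by
    intro k k' hkk'
    simp only [hGk, hℓk]
    have e1 := ballShift J t k' (fun z j => c z * β z j)
    have e2 := ballShift J t k (fun z j => c z * β z j)
    have e3 := ballShift J t k (fun z j => c z * b j)
    have e4 := ballShift J t k' (fun z j => c z * b j)
    rw [e1, e2, e3, e4]
    exact ballMass_le J c b β hc hb hbJ hblc hβ0 hβb hβz hβj (by omega)
  have hballZ : ∀ k k', k ≤ k' → Zk k' * ℓk k ≤ Zk k * ℓk k' := by
    intro k k' hkk'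
    simp only [hZk, hℓk]
    have e1 := ballShift J t k' (fun z j => c z * (if z = 1 then b j else 0))
    have e2 := ballShift J t k (fun z j => c z * (if z = 1 then b j else 0))
    have e3 := ballShift J t k (fun z j => c z * b j)
    have e4 := ballShift J t k' (fun z j => c z * b j)
    rw [e1, e2, e3, e4]
    refine ballMass_le J c b (fun z j => if z = 1 then b j else 0) hc hb hbJ hblc ?_ ?_ ?_ ?_ (by omega)
    · intro z j; split_ifs; exacts [hb j, le_rfl]
    · intro z j; split_ifs; exacts [le_rfl, hb j]
    · intro j; simp [hb j]
    · intro z j j' _; split_ifs; exacts [(mul_comm (b j) (b j')).le, by rw [zero_mul, zero_mul]]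
  have hℓmono : ∀ k k', k ≤ k' → ℓk k' ≤ ℓk k := fun k k' hkk' => by
    simp only [hℓk]; exact ballMass_antitone J t c b hc hb hkk'
  have hGmono : ∀ k k', k ≤ k' → G k' ≤ G k := by
    intro k k' hkk'
    by_cases hpos : 0 < ℓk k'
    · have hpos' : 0 < ℓk k := lt_of_lt_of_le hpos (hℓmono k k' hkk')
      have e1 : G k' = Gk k' / ℓk k' := by simp only [hG]; rw [if_pos hpos]
      have e2 : G k = Gk k / ℓk k := by simp only [hG]; rw [if_pos hpos']
      rw [e1, e2, div_le_div_iff₀ hpos hpos']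
      exact hball k k' hkk'
    · have e1 : G k' = 0 := by simp only [hG]; rw [if_neg hpos]
      rw [e1]; exact hG0 k
  have hFwmono : ∀ k k', k ≤ k' → Fw k' ≤ Fw k := by
    intro k k' hkk'
    by_cases hpos : 0 < ℓk k'
    · have hpos' : 0 < ℓk k := lt_of_lt_of_le hpos (hℓmono k k' hkk')
      have e1 : Fw k' = Zk k' / ℓk k' := by simp only [hFw]; rw [if_pos hpos]
      have e2 : Fw k = Zk k / ℓk k := by simp only [hFw]; rw [if_pos hpos']
      rw [e1, e2, div_le_div_iff₀ hpos hpos']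
      exact hballZ k k' hkk'
    · have e1 : Fw k' = 0 := by simp only [hFw]; rw [if_neg hpos]
      rw [e1]; exact hFw0 k
  have hF0 : ∀ k, 0 ≤ F k := fun k => by
    simp only [hF]; split_ifs; exacts [le_rfl, hFw0 k, zero_le_one]
  have hFle1 : ∀ k, F k ≤ 1 := fun k => by
    simp only [hF]; split_ifs; exacts [zero_le_one, hFwle1 k, le_rfl]
  -- (B) pair signs
  have hin : ∀ k k', k < k' → k' < K + 1 → (θ 1 ≤ k ∧ k < θ 0) → (θ 1 ≤ k' ∧ k' < θ 0) →
      0 ≤ (F k - F k') * (G k - G k') := by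
    intro k k' hkk' _ hk hk'
    have eF : F k = Fw k := by simp only [hF]; rw [if_neg (by omega), if_pos hk.2]
    have eF' : F k' = Fw k' := by simp only [hF]; rw [if_neg (by omega), if_pos hk'.2]
    rw [eF, eF']
    exact mul_nonneg (sub_nonneg.2 (hFwmono k k' hkk'.le)) (sub_nonneg.2 (hGmono k k' hkk'.le))
  have hout : ∀ k k', k < k' → k' < K + 1 → ¬ ((θ 1 ≤ k ∧ k < θ 0) ∧ (θ 1 ≤ k' ∧ k' < θ 0)) →
      (F k - F k') * (G k - G k') ≤ 0 := by
    intro k k' hkk' _ hnot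
    have hFF : F k ≤ F k' := by
      by_cases h1 : k < θ 1
      · have : F k = 0 := by simp only [hF]; rw [if_pos h1]
        rw [this]; exact hF0 k'
      · by_cases h0 : k < θ 0
        · -- `k ∈ W`, so `k' ∉ W`, hence `θ 0 ≤ k'`
          have hk' : ¬ k' < θ 0 := fun h => hnot ⟨⟨not_lt.1 h1, h0⟩, ⟨by omega, h⟩⟩
          have : F k' = 1 := by simp only [hF]; rw [if_neg (by omega), if_neg hk']
          rw [this]; exact hFle1 k
        · have e1 : F k = 1 := by simp only [hF]; rw [if_neg h1, if_neg h0]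
          have e2 : F k' = 1 := by simp only [hF]; rw [if_neg (by omega), if_neg (by omega)]
          rw [e1, e2]
    exact mul_nonpos_of_nonpos_of_nonneg (sub_nonpos.2 hFF) (sub_nonneg.2 (hGmono k k' hkk'.le))
  -- (C) pointwise evaluation of the per-`k` quantities
  have gbar_two : gbar = c 0 * (∑ j ∈ range (J + 1), β 0 j) + c 1 * (∑ j ∈ range (J + 1), β 1 j) := by
    simp only [hgbar]; rw [sum_range_two, Finset.mul_sum, Finset.mul_sum]
  have hg01 : (∑ j ∈ range (J + 1), β 0 j) ≤ ∑ j ∈ range (J + 1), β 1 j := Finset.sum_le_sum fun j _ => hβz j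
  have Gk_two : ∀ k, Gk k = (∑ j ∈ range (J + 1), if 0 + k + j < t then c 0 * β 0 j else 0) +
      ∑ j ∈ range (J + 1), if 1 + k + j < t then c 1 * β 1 j else 0 := fun k => by
    simp only [hGk]; rw [sum_range_two]
  have ℓk_two : ∀ k, ℓk k = (∑ j ∈ range (J + 1), if 0 + k + j < t then c 0 * b j else 0) +
      ∑ j ∈ range (J + 1), if 1 + k + j < t then c 1 * b j else 0 := fun k => by
    simp only [hℓk]; rw [sum_range_two]
  have Zk_one : ∀ k, Zk k = ∑ j ∈ range (J + 1), if 1 + k + j < t then c 1 * b j else 0 := fun k => by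
    simp only [hZk]; rw [sum_range_two]
    have h0 : (∑ j ∈ range (J + 1), if 0 + k + j < t then c 0 * (if (0:ℕ) = 1 then b j else 0) else 0) = 0 :=
      Finset.sum_eq_zero fun j _ => by
        rw [if_neg (show (0:ℕ) ≠ 1 by decide), mul_zero]; split_ifs <;> rfl
    rw [h0, zero_add]
    exact Finset.sum_congr rfl fun j _ => by rw [if_pos rfl]
  -- complement of a ball sum
  have compl_sum : ∀ (k : ℕ) (w : ℕ → ℕ → ℝ), (∑ z ∈ range 2, ∑ j ∈ range (J + 1), if z + k + j < t then 0 else w z j) =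
      (∑ z ∈ range 2, ∑ j ∈ range (J + 1), w z j) - ∑ z ∈ range 2, ∑ j ∈ range (J + 1), if z + k + j < t then w z j else 0 := by
    intro k w
    rw [eq_sub_iff_add_eq, ← Finset.sum_add_distrib]
    refine Finset.sum_congr rfl fun z _ => ?_
    rw [← Finset.sum_add_distrib]
    exact Finset.sum_congr rfl fun j _ => by split_ifs <;> ring
  have compl_sum1 : ∀ (k : ℕ) (w : ℕ → ℝ), (∑ j ∈ range (J + 1), if 1 + k + j < t then 0 else w j) =
      (∑ j ∈ range (J + 1), w j) - ∑ j ∈ range (J + 1), if 1 + k + j < t then w j else 0 := by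
    intro k w
    rw [eq_sub_iff_add_eq, ← Finset.sum_add_distrib]
    exact Finset.sum_congr rfl fun j _ => by split_ifs <;> ring
  -- the cheap lower bound on `E` over the window
  have hE_lb : ∀ k, -ℓk k ≤ E k := by
    intro k
    have hG1 : (∑ j ∈ range (J + 1), if 1 + k + j < t then c 1 * β 1 j else 0) ≤ Zk k := by
      rw [Zk_one]
      exact Finset.sum_le_sum fun j _ => by
        split_ifs; exacts [mul_le_mul_of_nonneg_left (hβb 1 j) (hc 1), le_rfl]
    have eΦ : Φ1 k = c 1 * (∑ j ∈ range (J + 1), β 1 j) - ∑ j ∈ range (J + 1), if 1 + k + j < t then c 1 * β 1 j else 0 := by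
      simp only [hΦ1]; rw [compl_sum1 k (fun j => c 1 * β 1 j), Finset.mul_sum]
    have hZG : 0 ≤ Zk k * G k := mul_nonneg (hZk0 k) (hG0 k)
    have hc0 : c 0 = 1 - c 1 := by linarith
    have key : Φ1 k - c 1 * gbar = c 1 * c 0 * ((∑ j ∈ range (J + 1), β 1 j) - ∑ j ∈ range (J + 1), β 0 j)
        - ∑ j ∈ range (J + 1), if 1 + k + j < t then c 1 * β 1 j else 0 := by
      rw [eΦ, gbar_two, hc0]; ring
    have : 0 ≤ c 1 * c 0 * ((∑ j ∈ range (J + 1), β 1 j) - ∑ j ∈ range (J + 1), β 0 j) :=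
      mul_nonneg (mul_nonneg (hc 1) (hc 0)) (sub_nonneg.2 hg01)
    simp only [hE]
    linarith [hZkle k]
  -- staircase per-`k` identities
  have stair_D : ∀ k, (∑ z ∈ range 2, ∑ j ∈ range (J + 1),
        if z + k + j < t then 0 else c z * (if θ z ≤ k then a k else 0) * β z j)
        - (∑ z ∈ range 2, c z * (if θ z ≤ k then a k else 0)) * gbar =
      (if θ 1 ≤ k ∧ k < θ 0 then a k * E k else 0) - u k * F k * G k := by
    intro k
    rw [sum_range_two, sum_range_two (fun z => c z * (if θ z ≤ k then a k else 0))]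
    by_cases h1 : θ 1 ≤ k
    · by_cases h0 : θ 0 ≤ k
      · -- region R1: both `z`-levels active
        rw [if_pos h0, if_pos h1, if_neg (fun h => absurd h.2 (not_lt.2 h0))]
        have eF : F k = 1 := by simp only [hF]; rw [if_neg (by omega), if_neg (by omega)]
        have e0 : (∑ j ∈ range (J + 1), if 0 + k + j < t then (0:ℝ) else c 0 * a k * β 0 j) =
            a k * ∑ j ∈ range (J + 1), if 0 + k + j < t then (0:ℝ) else c 0 * β 0 j := by
          rw [Finset.mul_sum]; exact Finset.sum_congr rfl fun j _ => by split_ifs <;> ring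
        have e1 : (∑ j ∈ range (J + 1), if 1 + k + j < t then (0:ℝ) else c 1 * a k * β 1 j) =
            a k * ∑ j ∈ range (J + 1), if 1 + k + j < t then (0:ℝ) else c 1 * β 1 j := by
          rw [Finset.mul_sum]; exact Finset.sum_congr rfl fun j _ => by split_ifs <;> ring
        have ec : (∑ j ∈ range (J + 1), if 0 + k + j < t then (0:ℝ) else c 0 * β 0 j) +
            (∑ j ∈ range (J + 1), if 1 + k + j < t then (0:ℝ) else c 1 * β 1 j) = gbar - Gk k := by
          have h := compl_sum k (fun z j => c z * β z j)
          rw [sum_range_two] at h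
          rw [h]
        rw [e0, e1, eF, ← mul_add, ec, hGkG k]
        simp only [hu]
        linear_combination (-(a k * gbar)) * hc1
      · -- region W
        rw [if_neg h0, if_pos h1, if_pos ⟨h1, not_le.1 h0⟩]
        have eF : F k = Fw k := by simp only [hF]; rw [if_neg (by omega), if_pos (not_le.1 h0)]
        have e0 : (∑ j ∈ range (J + 1), if 0 + k + j < t then (0:ℝ) else c 0 * 0 * β 0 j) = 0 :=
          Finset.sum_eq_zero fun j _ => by split_ifs <;> ring
        have e1 : (∑ j ∈ range (J + 1), if 1 + k + j < t then (0:ℝ) else c 1 * a k * β 1 j) = a k * Φ1 k := by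
          simp only [hΦ1]; rw [Finset.mul_sum]; exact Finset.sum_congr rfl fun j _ => by split_ifs <;> ring
        rw [e0, e1, eF, zero_add]
        simp only [hE, hu]
        rw [hZkF k]; ring
    · -- region R0
      have h0 : ¬ θ 0 ≤ k := fun h => h1 (hθ.trans h)
      rw [if_neg h0, if_neg h1, if_neg (fun h => h1 h.1)]
      have eF : F k = 0 := by simp only [hF]; rw [if_pos (not_le.1 h1)]
      have e0 : (∑ j ∈ range (J + 1), if 0 + k + j < t then (0:ℝ) else c 0 * 0 * β 0 j) = 0 :=
        Finset.sum_eq_zero fun j _ => by split_ifs <;> ring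
      have e1 : (∑ j ∈ range (J + 1), if 1 + k + j < t then (0:ℝ) else c 1 * 0 * β 1 j) = 0 :=
        Finset.sum_eq_zero fun j _ => by split_ifs <;> ring
      rw [e0, e1, eF]; ring
  have stair_Fh : ∀ k, (∑ z ∈ range 2, ∑ j ∈ range (J + 1),
        if z + k + j < t then c z * (if θ z ≤ k then a k else 0) * b j else 0) = u k * F k := by
    intro k
    rw [sum_range_two]
    by_cases h1 : θ 1 ≤ k
    · by_cases h0 : θ 0 ≤ k
      · rw [if_pos h0, if_pos h1]
        have eF : F k = 1 := by simp only [hF]; rw [if_neg (by omega), if_neg (by omega)]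
        rw [eF]
        simp only [hu]; rw [mul_one, ℓk_two, mul_add, Finset.mul_sum, Finset.mul_sum]
        congr 1 <;> exact Finset.sum_congr rfl fun j _ => by split_ifs <;> ring
      · rw [if_neg h0, if_pos h1]
        have eF : F k = Fw k := by simp only [hF]; rw [if_neg (by omega), if_pos (not_le.1 h0)]
        have e0 : (∑ j ∈ range (J + 1), if 0 + k + j < t then c 0 * 0 * b j else (0:ℝ)) = 0 :=
          Finset.sum_eq_zero fun j _ => by split_ifs <;> ring
        rw [e0, zero_add, eF]
        simp only [hu]; rw [mul_assoc, ← hZkF k, Zk_one, Finset.mul_sum]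
        exact Finset.sum_congr rfl fun j _ => by split_ifs <;> ring
    · have h0 : ¬ θ 0 ≤ k := fun h => h1 (hθ.trans h)
      rw [if_neg h0, if_neg h1]
      have eF : F k = 0 := by simp only [hF]; rw [if_pos (not_le.1 h1)]
      have e0 : (∑ j ∈ range (J + 1), if 0 + k + j < t then c 0 * 0 * b j else (0:ℝ)) = 0 :=
        Finset.sum_eq_zero fun j _ => by split_ifs <;> ring
      have e1 : (∑ j ∈ range (J + 1), if 1 + k + j < t then c 1 * 0 * b j else (0:ℝ)) = 0 :=
        Finset.sum_eq_zero fun j _ => by split_ifs <;> ring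
      rw [eF, e0, e1]; ring
  -- bit-slot per-`k` identities (restricted instance)
  have bit_D : ∀ k, (∑ z ∈ range 2, ∑ j ∈ range (J + 1),
        if z + k + j < t then 0 else c z * (if z = 1 then aW k else 0) * β z j)
        - (∑ z ∈ range 2, c z * (if z = 1 then aW k else 0)) * gbar = aW k * E k - uW k * Fw k * G k := by
    intro k
    rw [sum_range_two, sum_range_two (fun z => c z * (if z = 1 then aW k else 0))]
    simp only [show ((0:ℕ) = 1) = False from by simp, if_false, if_true]
    have e0 : (∑ j ∈ range (J + 1), if 0 + k + j < t then (0:ℝ) else c 0 * 0 * β 0 j) = 0 :=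
      Finset.sum_eq_zero fun j _ => by split_ifs <;> ring
    have e1 : (∑ j ∈ range (J + 1), if 1 + k + j < t then (0:ℝ) else c 1 * aW k * β 1 j) = aW k * Φ1 k := by
      simp only [hΦ1]; rw [Finset.mul_sum]; exact Finset.sum_congr rfl fun j _ => by split_ifs <;> ring
    rw [e0, e1, zero_add]
    simp only [hE, huW]
    rw [hZkF k]; ring
  have bit_Fh : ∀ k, (∑ z ∈ range 2, ∑ j ∈ range (J + 1),
        if z + k + j < t then c z * (if z = 1 then aW k else 0) * b j else 0) = uW k * Fw k := by
    intro k
    rw [sum_range_two]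
    simp only [show ((0:ℕ) = 1) = False from by simp, if_false, if_true]
    have e0 : (∑ j ∈ range (J + 1), if 0 + k + j < t then c 0 * 0 * b j else (0:ℝ)) = 0 :=
      Finset.sum_eq_zero fun j _ => by split_ifs <;> ring
    rw [e0, zero_add]
    simp only [huW]; rw [mul_assoc, ← hZkF k, Zk_one, Finset.mul_sum]
    exact Finset.sum_congr rfl fun j _ => by split_ifs <;> ring
  -- (D) pass to the k-forms
  have hk := kform K J t c a b (fun z k => if θ z ≤ k then a k else 0) β
  have hkW := kform K J t c (fun k => if θ 1 ≤ k ∧ k < θ 0 then a k else 0) b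
    (fun z k => if z = 1 then (if θ 1 ≤ k ∧ k < θ 0 then a k else 0) else 0) β
  rw [hgbar] at hW
  rw [hkW] at hW
  rw [hgbar, hk]
  -- per-`k` rewriting of the four sums, original instance
  have eP1 : (∑ k ∈ range (K + 1), a k * ∑ z ∈ range 2, ∑ j ∈ range (J + 1), if z + k + j < t then c z * b j else 0) =
      ∑ k ∈ range (K + 1), u k := Finset.sum_congr rfl fun k _ => rfl
  have eP2 : (∑ k ∈ range (K + 1), ((∑ z ∈ range 2, ∑ j ∈ range (J + 1),
        if z + k + j < t then 0 else c z * (if θ z ≤ k then a k else 0) * β z j)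
        - (∑ z ∈ range 2, c z * (if θ z ≤ k then a k else 0)) * (∑ z ∈ range 2, ∑ j ∈ range (J + 1), c z * β z j))) =
      (∑ k ∈ range (K + 1), (if θ 1 ≤ k ∧ k < θ 0 then a k * E k else 0)) - ∑ k ∈ range (K + 1), u k * F k * G k := by
    rw [← Finset.sum_sub_distrib]
    refine Finset.sum_congr rfl fun k _ => ?_
    rw [← hgbar]; exact stair_D k
  have eP3 : (∑ k ∈ range (K + 1), ∑ z ∈ range 2, ∑ j ∈ range (J + 1),
        if z + k + j < t then c z * (if θ z ≤ k then a k else 0) * b j else 0) = ∑ k ∈ range (K + 1), u k * F k :=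
    Finset.sum_congr rfl fun k _ => stair_Fh k
  have eP4 : (∑ k ∈ range (K + 1), a k * ∑ z ∈ range 2, ∑ j ∈ range (J + 1), if z + k + j < t then c z * β z j else 0) =
      ∑ k ∈ range (K + 1), u k * G k :=
    Finset.sum_congr rfl fun k _ => by
      show a k * Gk k = u k * G k
      simp only [hu]; rw [hGkG k, mul_assoc]
  -- restricted instance
  have eQ1 : (∑ k ∈ range (K + 1), (if θ 1 ≤ k ∧ k < θ 0 then a k else 0) *
        ∑ z ∈ range 2, ∑ j ∈ range (J + 1), if z + k + j < t then c z * b j else 0) = ∑ k ∈ range (K + 1), uW k :=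
    Finset.sum_congr rfl fun k _ => rfl
  have eQ2 : (∑ k ∈ range (K + 1), ((∑ z ∈ range 2, ∑ j ∈ range (J + 1),
        if z + k + j < t then 0 else c z * (if z = 1 then (if θ 1 ≤ k ∧ k < θ 0 then a k else 0) else 0) * β z j)
        - (∑ z ∈ range 2, c z * (if z = 1 then (if θ 1 ≤ k ∧ k < θ 0 then a k else 0) else 0)) *
          (∑ z ∈ range 2, ∑ j ∈ range (J + 1), c z * β z j))) =
      (∑ k ∈ range (K + 1), (if θ 1 ≤ k ∧ k < θ 0 then a k * E k else 0)) - ∑ k ∈ range (K + 1), uW k * Fw k * G k := by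
    rw [← Finset.sum_sub_distrib]
    refine Finset.sum_congr rfl fun k _ => ?_
    rw [← hgbar]
    have h := bit_D k
    have e : aW k * E k = if θ 1 ≤ k ∧ k < θ 0 then a k * E k else 0 := by
      simp only [haW]; split_ifs <;> ring
    rw [← e]; exact h
  have eQ3 : (∑ k ∈ range (K + 1), ∑ z ∈ range 2, ∑ j ∈ range (J + 1),
        if z + k + j < t then c z * (if z = 1 then (if θ 1 ≤ k ∧ k < θ 0 then a k else 0) else 0) * b j else 0) =
      ∑ k ∈ range (K + 1), uW k * Fw k :=
    Finset.sum_congr rfl fun k _ => bit_Fh k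
  have eQ4 : (∑ k ∈ range (K + 1), (if θ 1 ≤ k ∧ k < θ 0 then a k else 0) *
        ∑ z ∈ range 2, ∑ j ∈ range (J + 1), if z + k + j < t then c z * β z j else 0) = ∑ k ∈ range (K + 1), uW k * G k :=
    Finset.sum_congr rfl fun k _ => by
      show aW k * Gk k = uW k * G k
      simp only [huW]; rw [hGkG k, mul_assoc]
  rw [eP1, eP2, eP3, eP4]
  rw [eQ1, eQ2, eQ3, eQ4] at hW
  -- (E) the k-level inequality
  have hu0 : ∀ k, 0 ≤ u k := fun k => mul_nonneg (ha k) (hℓk0 k)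
  have huWon : ∀ k, (θ 1 ≤ k ∧ k < θ 0) → uW k = u k := fun k h => by simp only [huW, hu, haW]; rw [if_pos h]
  have huWoff : ∀ k, ¬ (θ 1 ≤ k ∧ k < θ 0) → uW k = 0 := fun k h => by simp only [huW, haW]; rw [if_neg h, zero_mul]
  have hFon : ∀ k, (θ 1 ≤ k ∧ k < θ 0) → F k = Fw k := fun k h => by
    simp only [hF]; rw [if_neg (not_lt.2 h.1), if_pos h.2]
  have hSE : -(∑ k ∈ range (K + 1), uW k) ≤ ∑ k ∈ range (K + 1), (if θ 1 ≤ k ∧ k < θ 0 then a k * E k else 0) := by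
    rw [← Finset.sum_neg_distrib]
    refine Finset.sum_le_sum fun k _ => ?_
    by_cases hWk : θ 1 ≤ k ∧ k < θ 0
    · rw [if_pos hWk, huWon k hWk]
      have := mul_le_mul_of_nonneg_left (hE_lb k) (ha k)
      simp only [hu]; linarith
    · rw [if_neg hWk, huWoff k hWk, neg_zero]
  exact klevel_ineq (K + 1) u uW F Fw G (fun k => if θ 1 ≤ k ∧ k < θ 0 then a k * E k else 0)
    (fun k => θ 1 ≤ k ∧ k < θ 0) hu0 huWon huWoff hFon hin hout hSE hW

end ThreeChain

end SahiOneStep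

end Summit.CriticalPhenomena.PercolationContinuityZ3.Theorems
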